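/-
Copyright (c) 2026. All rights reserved.
Released under Apache 2.0 license as described in the file LICENSE.
Authors: HodgeCM publication cell (pub-hodgecm), GR lane, seat own-crow (`pub-hodgecm-own-crow`, third hand);
the END assembly is GR-1's (`pub-hodgecm-own-real34`, `Prop311AsPrintedOfRecord`), run here pointwise.
-/
import Literature.NumberTheory.GelbartRogawski1991.CompatibleSplittingTotallyComplex
import Literature.NumberTheory.GelbartRogawski1991.Prop311AsPrintedOfRecord
import HarnessLib

/-!
# [GelbartRogawski1991, Proposition 3.1.1] AS PRINTED for every quadratic extension `E/F` with `E` TOTALLY COMPLEX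

Topic `NumberTheory/GelbartRogawski1991`; namespace `Literature.NumberTheory.GelbartRogawski1991.Prop311`.  KERNEL only: two
theorems; no definition, no named fact, no `sorry`, no instance attribute.

S. Gelbart, J. Rogawski, *L-functions and Fourier–Jacobi coefficients for the unitary group U(3)*, Invent. Math. 105 (1991),
§3.1 Proposition 3.1.1, p. 455 L1–2 ("The covering `π` splits over `G(𝐀)`.  There exists a continuous section
`s : G(𝐀) → Mp_𝐀(W)` such that `s(G(F))` is contained in `i(Sp_F(W))`"), typed statement-exact for EVERY quadratic extension of
number fields as `Prop311AsPrinted` (`Prop311AsPrinted.lean`; NOT inhabited: the archimedean half at the real places of `F`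
split in `E` is under construction, `Prop311AsPrintedOfArchHalf`).

THIS FILE proves the BODY of `Prop311AsPrinted`, both clauses, for every quadratic extension `E/F` of number fields with `E`
TOTALLY COMPLEX — `F` arbitrary (real and complex places), every `F`-automorphism `σ ≠ 1`, every non-trivial `ψ` of `F\𝐀`,
every skew-Hermitian `(V, Φ)` with `Tr_{E/F} Φ` non-degenerate, every irreducible unitary model `ρ` of `ρ_ψ`, THE rational
splitting `i`: **`prop311AsPrinted_of_isTotallyComplex`**.  This contains the CM case (`prop311AsPrinted_CM`,
`Prop311AsPrintedCM`: `E = L` a CM field, `F = L⁺`) and is unconditional.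

Route.  GR-2's `GRConstructionGen.compatibleSplitting_of_isTotallyComplex` (`CompatibleSplittingTotallyComplex`: the doubling
construction of [GR91 §3.2] / [Kudla1994 Thm 3.1] for diagonal hermitian data, `E` totally complex) is the record
`SplittingDatum.CompatibleSplitting` for `U(diag dV ⊗ diag dW)(𝐀_F)`; J9 (`pairLineCompatibleSplitting_of_diagonalCompatibleSplitting`)
run at the ambient `(F, E, σ)` turns it into the record for the dual-pair LINE datum `pairLineDatum F E σ … f e hT`
(**`compatibleSplitting_pairLineDatum_of_isTotallyComplex`**); and GR-1's END assembly
`prop311AsPrinted_of_pairLineCompatibleSplitting` (`Prop311AsPrintedOfRecord`) consumes its hypothesis only at the ambient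
`(F, E)`, so it runs verbatim at one totally complex `E` (steps (0)–(8) below are that proof, transcribed).

Written for the stage-1 cell `pub-hodgecm` (GR lane); nothing here is a claim of the manuscripts adjudicated by that cell;
`HC_CM` is not touched; `Prop311AsPrinted` is not inhabited here.

## References
* [GelbartRogawski1991] S. Gelbart, J. Rogawski, Invent. Math. 105 (1991) 445–472, §1.1 p. 449 L26–32, §3.1 p. 454 L17–42,
  Proposition 3.1.1 p. 455 L1–2, §3.2 p. 457.
* [Kudla1994] S. S. Kudla, Israel J. Math. 87 (1994) 361–401, Thm. 3.1.
* [CasselsFrohlichANT1967] J. W. S. Cassels, A. Fröhlich (eds.), *Algebraic Number Theory* (1967), Ch. XV Thm. 4.1.4.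
-/

set_option autoImplicit false

noncomputable section

open NumberField MeasureTheory Module
open scoped TensorProduct Matrix
open Literature.NumberTheory.Automorphic
open Literature.RepresentationTheory.HeisenbergGroup
open Literature.NumberTheory.Weil1964

namespace Literature.NumberTheory.GelbartRogawski1991

namespace Prop311

open UnitaryDualPair

/-- **the record for the dual-pair LINE datum, `E` totally complex** — [GelbartRogawski1991, Prop. 3.1.1] for
`U(T ⊗ 1)(𝐀_F)`, `T = diag(-2 d fᵢ)` invertible, in the tree's record form `SplittingDatum.CompatibleSplitting`, for every
quadratic `E/F` with `E` totally complex: J9 at the ambient `(F, E, σ)` (`N = n`, `M = 1`, `dVᵢ = -2 d fᵢ ≠ 0`, `dW = 1`,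
`compatibleSplitting_splittingDatum_congr`) applied to GR-2's `compatibleSplitting_of_isTotallyComplex`.
[cite: GelbartRogawski1991, §3.1 Proposition 3.1.1, p. 455 L1–2; §3.2 p. 457] [cite: Kudla1994, Thm 3.1] -/
theorem compatibleSplitting_pairLineDatum_of_isTotallyComplex (F : Type) [Field F] [NumberField F] (E : Type) [Field E]
    [NumberField E] [Algebra F E] [Algebra.IsQuadraticExtension F E] [IsTotallyComplex E] (σ : E ≃ₐ[F] E) {δ : E}
    (hσδ : σ δ = -δ) (hδ : δ ≠ 0) {d : F} (hd : δ * δ = algebraMap F E d) {n : ℕ} (f : Fin n → F)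
    (e : Fin n × Fin 1 ≃ Fin n) (hT : IsUnit (symplecticGram F d f).det) :
    (pairLineDatum F E σ hσδ hδ hd f e hT).CompatibleSplitting := by
  have hf0 : ∀ i, -2 * d * f i ≠ 0 := by
    have h1 : (∏ i, (-2 * d * f i)) ≠ 0 := by
      have h2 := hT.ne_zero
      rwa [symplecticGram, Matrix.det_diagonal] at h2
    exact fun i => (Finset.prod_ne_zero_iff.1 h1) i (Finset.mem_univ i)
  have h1 := GRConstructionGen.compatibleSplitting_of_isTotallyComplex F E σ hσδ hδ hd e (fun i => -2 * d * f i)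
    (Matrix.isSymm_diagonal fun i => -2 * d * f i) (isUnit_det_diagonal_of_ne_zero (fun i => -2 * d * f i) hf0) hf0
    (fun _ => (1 : F)) (Matrix.isSymm_diagonal fun _ : Fin 1 => (1 : F))
    (isUnit_det_diagonal_of_ne_zero (fun _ : Fin 1 => (1 : F)) fun _ => one_ne_zero) (fun _ => one_ne_zero)
  exact (compatibleSplitting_splittingDatum_congr F E σ n 1 e hσδ hδ hd
    (Matrix.isSymm_diagonal fun i => -2 * d * f i) (Matrix.isSymm_diagonal fun _ : Fin 1 => (1 : F))
    (isUnit_det_diagonal_of_ne_zero (fun i => -2 * d * f i) hf0)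
    (isUnit_det_diagonal_of_ne_zero (fun _ : Fin 1 => (1 : F)) fun _ => one_ne_zero) rfl rfl
    (isSymm_symplecticGram F d f) Matrix.isSymm_one hT (by rw [Matrix.det_one]; exact isUnit_one) rfl (one_eq_map_one F E)
    rfl Matrix.diagonal_one.symm rfl (by rw [Matrix.diagonal_one]; exact one_eq_map_one F E)).1 h1

/-- **[GelbartRogawski1991, Proposition 3.1.1] AS PRINTED, for every quadratic extension of number fields `E/F` with `E`
TOTALLY COMPLEX** (the body of `Prop311AsPrinted` at such `(F, E)`, both clauses; `F` arbitrary): for every `F`-automorphism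
`σ ≠ 1` of `E`, every non-trivial character `ψ` of `F\𝐀`, every skew-Hermitian space `(V, Φ)` over `E` with `Tr_{E/F} Φ`
non-degenerate, every irreducible unitary representation `ρ` of `H_𝐀(W)` with central character `ψ` on a Hilbert space and THE
rational splitting `i` — "(1) the covering `π` splits over `G(𝐀)`; (2) there exists a continuous section `s : G(𝐀) → Mp_𝐀(W)` such
that `s(G(F))` is contained in `i(Sp_F(W))`".  Proof: GR-1's END assembly `prop311AsPrinted_of_pairLineCompatibleSplitting`, steps
(0)–(8), run at the ambient `(F, E)` with the record supplied by `compatibleSplitting_pairLineDatum_of_isTotallyComplex`.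
[cite: GelbartRogawski1991, §3.1 Proposition 3.1.1, p. 455 L1–2; §1.1 p. 449 L26–32; §3.1 p. 454 L17–42]
[cite: CasselsFrohlichANT1967, Ch. XV Thm 4.1.4] -/
theorem prop311AsPrinted_of_isTotallyComplex (F : Type) [Field F] [NumberField F]
    (E : Type) [Field E] [Algebra F E] [Algebra.IsQuadraticExtension F E] [IsTotallyComplex E]
    (σ : E ≃ₐ[F] E) (hσ : σ ≠ 1)
    (ψ : AddChar (AdeleRing (𝓞 F) F) Circle) (hψc : Continuous ψ)
    (hψF : ∀ x : F, ψ (algebraMap F (AdeleRing (𝓞 F) F) x) = 1) (hψ1 : ψ ≠ 1)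
    (n : ℕ) (V : Type) [AddCommGroup V] [Module F V] [Module E V] [IsScalarTower F E V]
    [FiniteDimensional E V] (_hn : Module.finrank E V = n)
    (Φ : V →ₗ[F] V →ₗ[F] E)
    (hΦ₁ : ∀ (e : E) (x y : V), Φ (e • x) y = e * Φ x y)
    (hΦ₂ : ∀ (e : E) (x y : V), Φ x (e • y) = Φ x y * σ e)
    (hΦ₃ : ∀ x y : V, Φ y x = -σ (Φ x y))
    (hφ : (traceForm F E V Φ).Nondegenerate)
    (S : Type) [NormedAddCommGroup S] [InnerProductSpace ℂ S] [CompleteSpace S]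
    (ρ : Representation ℂ (AdelicHeisenberg F E V Φ) S)
    (hρu : ∀ (h : AdelicHeisenberg F E V Φ) (f : S), ‖ρ h f‖ = ‖f‖)
    (hρc : ∀ f : S, @Continuous _ _ (heisenbergTopology F E V Φ) _ fun h => ρ h f)
    (hρi : ∀ K : Submodule ℂ S, IsClosed (K : Set S) →
      (∀ (h : AdelicHeisenberg F E V Φ), ∀ f ∈ K, ρ h f ∈ K) → K = ⊥ ∨ K = ⊤)
    (hρz : ∀ (t : AdeleRing (𝓞 F) F) (f : S),
      ρ (Heisenberg.ofCenter (heisForm F E V Φ) (Multiplicative.ofAdd t)) f = ((ψ t : Circle) : ℂ) • f)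
    (i : ratSp F E V Φ →* adelicMp F E V Φ ρ) (hi : IsRationalSplitting F E V Φ ρ i)
    (_hi! : ∀ i' : ratSp F E V Φ →* adelicMp F E V Φ ρ, IsRationalSplitting F E V Φ ρ i' → i' = i) :
    (∃ s : adelicUnitary F E V Φ →* adelicMp F E V Φ ρ,
        ∀ g : adelicUnitary F E V Φ,
          projEnd F E V Φ ρ (s g) =
            ((g : AdelicSpace F V ≃ₗ[AdeleRing (𝓞 F) F] AdelicSpace F V) :
              AdelicSpace F V →ₗ[AdeleRing (𝓞 F) F] AdelicSpace F V)) ∧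
      ∃ s : adelicUnitary F E V Φ →* adelicMp F E V Φ ρ,
        Continuous s ∧
        (∀ g : adelicUnitary F E V Φ,
          projEnd F E V Φ ρ (s g) =
            ((g : AdelicSpace F V ≃ₗ[AdeleRing (𝓞 F) F] AdelicSpace F V) :
              AdelicSpace F V →ₗ[AdeleRing (𝓞 F) F] AdelicSpace F V)) ∧
        ∀ g : adelicUnitary F E V Φ,
          IsRationalPoint F E V Φ (g : AdelicSpace F V ≃ₗ[AdeleRing (𝓞 F) F] AdelicSpace F V) →
            s g ∈ i.range := by
  -- `E` is a number field; `δ` with `σ δ = -δ ≠ 0`, `δ² = d ∈ F`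
  haveI : Module.Finite F E := Module.finite_of_finrank_eq_succ (Algebra.IsQuadraticExtension.finrank_eq_two F E)
  haveI : NumberField E := NumberField.of_module_finite F E
  have hdelta := exists_delta_of_algEquiv_ne_one F E σ hσ
  obtain ⟨δ, d, hσδ, hδ, hd⟩ := hdelta
  -- (0) the degenerate model `S = 0`
  by_cases hS : Nontrivial S
  swap
  · haveI : Subsingleton S := not_nontrivial_iff_subsingleton.1 hS
    exact conclusion_of_subsingleton F E V Φ ρ i hi
  haveI : Nontrivial S := hS
  -- (1) Tate: `ψ = ψ_F(ξ ·)`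
  -- (`have` before every `obtain`: `rcases` on a non-variable term generalizes it over this very large goal)
  have hψg : IsGlobalAddChar F ψ := ⟨hψc, hψF, hψ1⟩
  have hTate := hψg.exists_eq_mulShift_adeleAddChar
  obtain ⟨ξ, hξ, hψ⟩ := hTate
  have hψ₀ := isGlobalAddChar_adeleAddChar F
  -- (2) the rescaled skew-Hermitian space `(V, ξΦ)`
  have hΦ₁' := smul_form_linear_left F E V Φ (ξ := ξ) hΦ₁
  have hΦ₂' := smul_form_semilinear_right F E V Φ (ξ := ξ) σ hΦ₂
  have hΦ₃' := smul_form_skew F E V Φ (ξ := ξ) σ hΦ₃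
  have hφ' := nondegenerate_traceForm_smul F E V Φ hξ hφ
  -- (3) a `ξΦ`-orthogonal basis with `δ`-imaginary diagonal, and the line enumeration
  have hbasis := exists_orthogonal_basis_imaginary F E σ hσδ hδ hd (ξ • Φ) hΦ₁' hΦ₃'
  obtain ⟨b, f, hb, hf⟩ := hbasis
  let e : Fin (finrank E V) × Fin 1 ≃ Fin (finrank E V) := Equiv.prodUnique (Fin (finrank E V)) (Fin 1)
  have he : ∀ k : Fin (finrank E V), (e.symm k).1 = k := fun k => rfl
  -- (4) a Haar measure on `𝐀_Fⁿ` and the `L²` model of `(V, ξΦ)` in the Darboux frame of `b`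
  letI : MeasurableSpace (AdeleRing (𝓞 F) F) := borel _
  haveI : BorelSpace (AdeleRing (𝓞 F) F) := ⟨rfl⟩
  haveI : SecondCountableTopology (AdeleRing (𝓞 F) F) := secondCountableTopology_adeleRing _
  haveI : LocallyCompactSpace (AdeleRing (𝓞 F) F) := locallyCompactSpace_adeleRing' _
  haveI : BorelSpace (Fin (finrank E V) → AdeleRing (𝓞 F) F) := Pi.borelSpace
  let ν : Measure (Fin (finrank E V) → AdeleRing (𝓞 F) F) := Measure.addHaarMeasure (Classical.arbitrary _)
  have hψc₀ : Continuous (adeleAddChar F : AdeleRing (𝓞 F) F → Circle) := hψ₀.continuous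
  have hβc := continuous_adelicForm_left F (Fin (finrank E V))
    (1 : Matrix (Fin (finrank E V)) (Fin (finrank E V)) (AdeleRing (𝓞 F) F))
  -- (5) the body of Prop. 3.1.1 for the `L²` model of `(V, ξΦ)`, FROM THE RECORD at `(F, E, σ, δ; f, e)` — `E` totally complex
  have hT := isUnit_det_lineGram_of_nondegenerate F E σ hδ hd V b (ξ • Φ) f hΦ₁' hΦ₂' hb hf hφ'
  have hrec' : (pairLineDatum F E σ hσδ hδ hd f e hT).CompatibleSplitting :=
    compatibleSplitting_pairLineDatum_of_isTotallyComplex F E σ hσδ hδ hd f e hT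
  have hL := prop311_L2_of_record F E σ hσδ hδ hd V b (ξ • Φ) f e he hΦ₁' hΦ₂' hb hf hφ' ν hψc₀ hβc hΦ₃' hT hrec'
  obtain ⟨iL, hiL, -, hL'⟩ := hL
  -- (6) the rescaled model `ρ ∘ τ_ξ` (central character `ψ_F`) and a rational splitting for it
  have hmodel := comp_heisTwist_printed_binders hξ ρ ψ (adeleAddChar F) hψ hρu hρc hρi hρz
  obtain ⟨hρ'u, hρ'c, hρ'i, hρ'z⟩ := hmodel
  have hsplit := exists_isRationalSplitting_smul hξ ρ i hi
  obtain ⟨i', hi'⟩ := hsplit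
  -- (7) uniqueness of `ρ_ψ`: the body for the `L²` model gives it for `ρ ∘ τ_ξ`
  haveI : Nontrivial (Lp ℂ 2 ν) := nontrivial_L2_adele ν
  have h7 := conclusion_of_conclusion F E V (ξ • Φ) σ (adeleAddChar F) hψc₀ hψ₀.map_algebraMap hψ₀.ne_one hΦ₃' hφ' S _
    hρ'u hρ'c hρ'i hρ'z i' hi' (Lp ℂ 2 ν)
    (l2Model F E σ hσδ hδ hd V b (ξ • Φ) f e he hΦ₁' hΦ₂' hb hf hφ' ν hψc₀ hβc)
    (norm_l2Model F E σ hσδ hδ hd V b (ξ • Φ) f e he hΦ₁' hΦ₂' hb hf hφ' ν hψc₀ hβc)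
    (continuous_rep_comp_toCoordHeisenberg _ _ (adeleAddChar F) hψc₀ hβc ν)
    (irreducible_rep_comp_toCoordHeisenberg _ _ (adeleAddChar F) hψc₀ hβc ν hψ₀)
    (rep_comp_toCoordHeisenberg_ofCenter _ _ (adeleAddChar F) hψc₀ hβc ν) iL hiL hL'
  -- (8) undo the rescaling
  exact conclusion_of_conclusion_smul hξ ρ σ hΦ₃ hφ hρu hρi i hi i' hi' h7

end Prop311

end Literature.NumberTheory.GelbartRogawski1991

end
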